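import Summits.Ventures.HodgeRepro2.T5SU11LegendreDerivativeSum
import Summits.Ventures.HodgeRepro2.T5SU11LegendreTuran

/-!
# Every derivative of `P_n` is a positive combination of Legendre polynomials, hence `|P_n^{(k)}(x)| ≤ P_n^{(k)}(1)`
on `[−1, 1]` — Markov's bound for all derivatives

Row 404 telescoped the first derivative: `P'_{2m} = Σ_{j<m} (4j + 3) P_{2j+1}`, `P'_{2m+1} = Σ_{j≤m} (4j + 1) P_{2j}`, with
positive coefficients. Differentiating a positive combination of Legendre polynomials therefore gives a positive
combination again (`IsPosComb`, `IsPosComb.derivative`), so by induction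

  **`P_n^{(k)} = Σ_j c_j P_j` with all `c_j ≥ 0`** for every `k`   (`isPosComb_legD`),

and since `|P_j| ≤ 1` on `[−1, 1]` with `P_j(1) = 1` (row 385),

  **`|P_n^{(k)}(x)| ≤ P_n^{(k)}(1)` for `x ∈ [−1, 1]` and every `k`**   (`abs_eval_legD_le`),
  **`P_n^{(k)}(x) ≥ P_n^{(k)}(1) ≥ 0` for `x ≥ 1`**   (`eval_legD_one_le_eval`, `eval_legD_one_nonneg`):

the derivatives of the Legendre polynomials attain their maximum modulus on `[−1, 1]` at the endpoint `x = 1`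
(`k = 0` is row 385, `k = 1` is row 404's Markov bound). Nothing is claimed about (N).

Blind lane: Mathlib + the HodgeRepro2 prefix only; no sorry; axioms ⊆ {propext, Classical.choice,
Quot.sound}.
-/

namespace Summit.Ventures.HodgeRepro2.T5SU11LegendreDerivativeBound

open Polynomial Finset Set
open T5SU11SphericalLegendreAll T5SU11SphericalLegendreLaplace T5SU11LegendreIdentities T5SU11LegendreBound
  T5SU11JacobiPhaseLawEven T5SU11LegendreDerivativeSum T5SU11LegendreTuran

/-! ### Positive combinations of Legendre polynomials -/

/-- **A positive combination of Legendre polynomials**: `p = Σ_{j < N} c_j · legPoly j` with all `c_j ≥ 0`. -/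
def IsPosComb (p : ℝ[X]) : Prop :=
  ∃ (N : ℕ) (c : ℕ → ℝ), (∀ j, 0 ≤ c j) ∧ p = ∑ j ∈ range N, C (c j) * legPoly j

/-- `legPoly n` is a positive combination. -/
theorem isPosComb_legPoly (n : ℕ) : IsPosComb (legPoly n) :=
  ⟨n + 1, fun j => if j = n then 1 else 0, fun j => by dsimp only; split_ifs <;> norm_num, by
    rw [Finset.sum_eq_single n]
    · simp
    · intro j _ hj
      simp [hj]
    · intro h
      exact absurd (Finset.mem_range.mpr (Nat.lt_succ_self n)) h⟩

/-- Positive combinations are closed under sums. -/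
theorem IsPosComb.add {p q : ℝ[X]} (hp : IsPosComb p) (hq : IsPosComb q) : IsPosComb (p + q) := by
  obtain ⟨N, c, hc, rfl⟩ := hp
  obtain ⟨M, d, hd, rfl⟩ := hq
  have e1 : ∀ (K : ℕ) (f : ℕ → ℝ), K ≤ max N M →
      ∑ j ∈ range (max N M), C (if j < K then f j else 0) * legPoly j = ∑ j ∈ range K, C (f j) * legPoly j := by
    intro K f h
    rw [← Finset.sum_range_add_sum_Ico _ h]
    rw [Finset.sum_eq_zero (s := Finset.Ico _ _) fun j hj => by
      rw [if_neg (by have := (Finset.mem_Ico.mp hj).1; omega), map_zero, zero_mul], add_zero]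
    exact Finset.sum_congr rfl fun j hj => by rw [if_pos (Finset.mem_range.mp hj)]
  refine ⟨max N M, fun j => (if j < N then c j else 0) + (if j < M then d j else 0), ?_, ?_⟩
  · intro j
    dsimp only
    exact add_nonneg (by split_ifs <;> simp [hc]) (by split_ifs <;> simp [hd])
  · simp_rw [map_add, add_mul, Finset.sum_add_distrib]
    rw [e1 N c (le_max_left N M), e1 M d (le_max_right N M)]

/-- Positive combinations are closed under non-negative scalars. -/
theorem IsPosComb.smul {p : ℝ[X]} (hp : IsPosComb p) {a : ℝ} (ha : 0 ≤ a) : IsPosComb (C a * p) := by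
  obtain ⟨N, c, hc, rfl⟩ := hp
  refine ⟨N, fun j => a * c j, fun j => mul_nonneg ha (hc j), ?_⟩
  rw [Finset.mul_sum]
  exact Finset.sum_congr rfl fun j _ => by rw [map_mul, mul_assoc]

/-- Finite sums of positive combinations are positive combinations. -/
theorem isPosComb_sum {ι : Type*} (s : Finset ι) (f : ι → ℝ[X]) (hf : ∀ i ∈ s, IsPosComb (f i)) :
    IsPosComb (∑ i ∈ s, f i) := by
  classical
  induction s using Finset.induction_on with
  | empty => exact ⟨0, fun _ => 0, fun _ => le_rfl, by simp⟩
  | insert a s ha ih =>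
    rw [Finset.sum_insert ha]
    exact (hf a (Finset.mem_insert_self a s)).add (ih fun i hi => hf i (Finset.mem_insert_of_mem hi))

/-! ### The derivative of a Legendre polynomial is a positive combination -/

/-- Row 404 in polynomial form: `D legPoly (2m) = Σ_{j<m} (4j + 3) legPoly (2j + 1)`. -/
theorem derivative_legPoly_even (m : ℕ) :
    derivative (legPoly (2 * m)) = ∑ j ∈ range m, C (4 * (j : ℝ) + 3) * legPoly (2 * j + 1) := by
  apply Polynomial.funext
  intro x
  rw [eval_derivative_legPoly, legQ_even_eq_sum, eval_finsetSum]
  exact Finset.sum_congr rfl fun j _ => by rw [eval_mul, eval_C, ← legP_eq_eval]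

/-- Row 404 in polynomial form: `D legPoly (2m + 1) = Σ_{j≤m} (4j + 1) legPoly (2j)`. -/
theorem derivative_legPoly_odd (m : ℕ) :
    derivative (legPoly (2 * m + 1)) = ∑ j ∈ range (m + 1), C (4 * (j : ℝ) + 1) * legPoly (2 * j) := by
  apply Polynomial.funext
  intro x
  rw [eval_derivative_legPoly, legQ_odd_eq_sum, eval_finsetSum]
  exact Finset.sum_congr rfl fun j _ => by rw [eval_mul, eval_C, ← legP_eq_eval]

/-- **`D legPoly n` is a positive combination** for every `n`. -/
theorem isPosComb_derivative_legPoly (n : ℕ) : IsPosComb (derivative (legPoly n)) := by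
  rcases Nat.even_or_odd' n with ⟨m, rfl | rfl⟩
  · rw [derivative_legPoly_even]
    exact isPosComb_sum _ _ fun j _ => (isPosComb_legPoly _).smul (by positivity)
  · rw [derivative_legPoly_odd]
    exact isPosComb_sum _ _ fun j _ => (isPosComb_legPoly _).smul (by positivity)

/-- **The derivative of a positive combination is a positive combination.** -/
theorem IsPosComb.derivative {p : ℝ[X]} (hp : IsPosComb p) : IsPosComb (derivative p) := by
  obtain ⟨N, c, hc, rfl⟩ := hp
  rw [derivative_sum]
  refine isPosComb_sum _ _ fun j _ => ?_
  rw [derivative_mul, derivative_C, zero_mul, zero_add]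
  exact (isPosComb_derivative_legPoly j).smul (hc j)

/-- **Every derivative `P_n^{(k)}` is a positive combination of Legendre polynomials.** -/
theorem isPosComb_legD (n k : ℕ) : IsPosComb (legD n k) := by
  induction k with
  | zero => exact isPosComb_legPoly n
  | succ k ih =>
    rw [legD_succ]
    exact ih.derivative

/-! ### The bounds -/

/-- **A positive combination is bounded on `[−1, 1]` by its value at `1`**: `|p(x)| ≤ p(1)`. -/
theorem IsPosComb.abs_eval_le {p : ℝ[X]} (hp : IsPosComb p) {x : ℝ} (hx : x ∈ Icc (-1 : ℝ) 1) :
    |p.eval x| ≤ p.eval 1 := by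
  obtain ⟨N, c, hc, rfl⟩ := hp
  simp_rw [eval_finsetSum, eval_mul, eval_C, ← legP_eq_eval, legP_one, mul_one]
  calc |∑ j ∈ range N, c j * legP j x| ≤ ∑ j ∈ range N, |c j * legP j x| := Finset.abs_sum_le_sum_abs _ _
    _ ≤ ∑ j ∈ range N, c j := by
        refine Finset.sum_le_sum fun j _ => ?_
        rw [abs_mul, abs_of_nonneg (hc j)]
        exact mul_le_of_le_one_right (hc j) (abs_legP_le_one j hx)

/-- **A positive combination is `≥ its value at 1 ≥ 0` on `[1, ∞)`.** -/
theorem IsPosComb.eval_one_le_eval {p : ℝ[X]} (hp : IsPosComb p) {x : ℝ} (hx : 1 ≤ x) :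
    0 ≤ p.eval 1 ∧ p.eval 1 ≤ p.eval x := by
  letI : MeasurableSpace Circle := borel Circle
  haveI : BorelSpace Circle := ⟨rfl⟩
  obtain ⟨N, c, hc, rfl⟩ := hp
  simp_rw [eval_finsetSum, eval_mul, eval_C, ← legP_eq_eval, legP_one, mul_one]
  constructor
  · exact Finset.sum_nonneg fun j _ => hc j
  · exact Finset.sum_le_sum fun j _ => le_mul_of_one_le_right (hc j) (one_le_legP j hx)

/-- **MARKOV'S BOUND FOR ALL DERIVATIVES**: `|P_n^{(k)}(x)| ≤ P_n^{(k)}(1)` on `[−1, 1]`. -/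
theorem abs_eval_legD_le (n k : ℕ) {x : ℝ} (hx : x ∈ Icc (-1 : ℝ) 1) : |(legD n k).eval x| ≤ (legD n k).eval 1 :=
  (isPosComb_legD n k).abs_eval_le hx

/-- **`P_n^{(k)}(x) ≥ P_n^{(k)}(1) ≥ 0` for `x ≥ 1`.** -/
theorem eval_legD_one_le_eval (n k : ℕ) {x : ℝ} (hx : 1 ≤ x) : (legD n k).eval 1 ≤ (legD n k).eval x :=
  ((isPosComb_legD n k).eval_one_le_eval hx).2

/-- `P_n^{(k)}(1) ≥ 0`. -/
theorem eval_legD_one_nonneg (n k : ℕ) : 0 ≤ (legD n k).eval 1 :=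
  ((isPosComb_legD n k).eval_one_le_eval le_rfl).1

/-- The cross-checks: `k = 0` is `|P_n| ≤ 1`, `k = 1` is Markov's bound `|P'_n| ≤ n(n + 1)/2`. -/
theorem abs_eval_legD_le_zero_one (n : ℕ) {x : ℝ} (hx : x ∈ Icc (-1 : ℝ) 1) :
    |legP n x| ≤ 1 ∧ |legQ n x| ≤ (n : ℝ) * (n + 1) / 2 := by
  constructor
  · have h := abs_eval_legD_le n 0 hx
    rwa [legD_zero, ← legP_eq_eval, ← legP_eq_eval, legP_one] at h
  · have h := abs_eval_legD_le n 1 hx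
    rwa [legD_one, eval_derivative_legPoly, eval_derivative_legPoly, legQ_one_eq] at h

end Summit.Ventures.HodgeRepro2.T5SU11LegendreDerivativeBound
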